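import Literature.NumberTheory.EllipticCurves.ModularSymbolRepProofs
import Literature.NumberTheory.Transcendental.KZSemialgebraicComplex
import Literature.NumberTheory.Transcendental.SemialgebraicLineDeriv
import Literature.ModelTheory.ExponentialFields.SemialgebraicInterior
import Mathlib.Algebra.MvPolynomial.Funext
import Mathlib.Topology.Sequences

/-!
# `StokesGeneration` (stmt-KontsevichZagierPeriods-3586), line `Sketch`, stub `stub_spanToReps` — part 2:
a continuous real part of a solution of a rational polynomial identity is `ℚ`-semialgebraic

Support file for the registered stub `stub_spanToReps` (dictionary, folding half) of the crux
`StokesGeneration` (route UnfoldedStokes, line `Sketch` = card cube-type-a-generation).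

Let `W ⊆ ℝᴹ` be open and `ℚ`-semialgebraic, `g : ℝᴹ → ℝ` continuous on `W`, and suppose `g = re k`
on `W` for a complex-valued `k` satisfying a polynomial identity `Σₙ qₙ(x) k(x)ⁿ = 0` (`x ∈ W`) with
`qₙ ∈ ℚ[x₁, …, x_M]` not all zero. Then `g` is `ℚ`-semialgebraic on `W`
(`isSemialgebraicFunOn_re_of_polynomial_identity`):

* over the `ℚ`-semialgebraic set `D = {x ∈ W | some qₙ(x) ≠ 0}` the graph of `g` lies in the
  projection `{(x, t) | ∃ u, Σₙ qₙ(x) (t + iu)ⁿ = 0, some qₙ(x) ≠ 0}` (Tarski–Seidenberg) of a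
  `ℚ`-semialgebraic subset of `ℝᴹ⁺²`, whose vertical fibres are finite (real parts of the roots of a
  non-zero complex polynomial), so `g` is semialgebraic on `D` by semialgebraic selection along a
  continuous branch (the tree's `isSemialgebraicFunOn_of_continuousOn_of_finite_fibres`: cylindrical
  decomposition and connectedness of cells, Basu–Pollack–Roy 2006, Thm. 5.6, Cor. 5.7);
* `D` is dense in `W` (the zero set of a non-zero polynomial has empty interior), so by continuity
  the graph of `g` over `W` is the trace over `W` of the closure of its graph over `D`, and closures
  of semialgebraic sets are semialgebraic.

This is the semialgebraicity input ("sums of algebraic power series are Nash functions",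
Bochnak–Coste–Roy 1998, §8.1) of the folding half of the dictionary between Ayoub's series
`𝒪_{ℚ̄-alg}(𝔻̄^∞)` and real functions near the closed unit cube (J. Ayoub, EMS Newsl. 91 (2014)
§2.2, Def. 9–10, Rem. 13). No definition is introduced.
-/

noncomputable section

-- `Summit.KontsevichZagierPeriods.KontsevichZagierPeriods.…` is the tree's mandated layout (single-conjunct summit).
set_option linter.dupNamespace false

namespace Summit.KontsevichZagierPeriods.KontsevichZagierPeriods.StokesGenerationLine

open Set Filter MvPolynomial
open scoped Topology
open Literature.ModelTheory.ExponentialFields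
open Literature.NumberTheory.Transcendental
open Literature.NumberTheory.EllipticCurves.ModularForms (isSemialgebraicFunOn_of_continuousOn_of_finite_fibres)

/-! ## Semialgebraic bookkeeping -/

section Bookkeeping

variable {m : ℕ} {s : Set (Fin m → ℝ)}

/-- The zero set, inside `s`, of a real `ℚ`-semialgebraic function is `ℚ`-semialgebraic.
[cite: BochnakCosteRoy1998, §2.2] -/
theorem isSemialgebraic_sep_eq_zero {f : (Fin m → ℝ) → ℝ} (hf : IsSemialgebraicFunOn ℚ s f) :
    IsSemialgebraic ℚ {x | x ∈ s ∧ f x = 0} := by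
  have h1 := hf.isSemialgebraic_sep_nonneg
  have h2 := hf.neg.isSemialgebraic_sep_nonneg
  convert h1.inter h2 using 1
  ext x
  simp only [mem_setOf_eq, mem_inter_iff, Pi.neg_apply, neg_nonneg]
  constructor
  · rintro ⟨hx, h0⟩
    exact ⟨⟨hx, h0.symm.le⟩, hx, h0.le⟩
  · rintro ⟨⟨hx, h0⟩, -, h0'⟩
    exact ⟨hx, le_antisymm h0' h0⟩

/-- The zero set, inside `s`, of a complex-valued function with `ℚ`-semialgebraic real and
imaginary parts is `ℚ`-semialgebraic. [cite: BochnakCosteRoy1998, §2.2] -/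
theorem isSemialgebraic_sep_eq_zero_complex {F : (Fin m → ℝ) → ℂ}
    (hF : IsSemialgebraicFunOn ℚ s (fun x => (F x).re) ∧ IsSemialgebraicFunOn ℚ s (fun x => (F x).im)) :
    IsSemialgebraic ℚ {x | x ∈ s ∧ F x = 0} := by
  convert (isSemialgebraic_sep_eq_zero hF.1).inter (isSemialgebraic_sep_eq_zero hF.2) using 1
  ext x
  simp only [mem_setOf_eq, mem_inter_iff, Complex.ext_iff, Complex.zero_re, Complex.zero_im]
  tauto

/-- Finite sums of complex-valued functions with semialgebraic real and imaginary parts have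
semialgebraic real and imaginary parts. [cite: BochnakCosteRoy1998, Prop. 2.2.6] -/
theorem re_im_finset_sum (hs : IsSemialgebraic ℚ s) {ι : Type*} (t : Finset ι)
    (F : ι → (Fin m → ℝ) → ℂ)
    (hF : ∀ i ∈ t, IsSemialgebraicFunOn ℚ s (fun x => (F i x).re) ∧
      IsSemialgebraicFunOn ℚ s (fun x => (F i x).im)) :
    IsSemialgebraicFunOn ℚ s (fun x => (∑ i ∈ t, F i x).re) ∧
      IsSemialgebraicFunOn ℚ s (fun x => (∑ i ∈ t, F i x).im) := by
  classical
  induction t using Finset.induction_on with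
  | empty =>
    refine ⟨?_, ?_⟩
    · simpa using isSemialgebraicFunOn_natCast (k := ℚ) (R := ℝ) hs 0
    · simpa using isSemialgebraicFunOn_natCast (k := ℚ) (R := ℝ) hs 0
  | insert a t ha ih =>
    have h := re_im_add (hF a (Finset.mem_insert_self a t))
      (ih fun i hi => hF i (Finset.mem_insert_of_mem hi))
    simpa [Finset.sum_insert ha] using h

/-- A non-zero rational polynomial does not vanish at some real point. [folklore] -/
theorem exists_aeval_ne_zero {M : ℕ} {q : MvPolynomial (Fin M) ℚ} (hq : q ≠ 0) :
    ∃ x : Fin M → ℝ, aeval x q ≠ 0 := by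
  by_contra h
  push Not at h
  apply hq
  have h' : MvPolynomial.map (algebraMap ℚ ℝ) q = 0 :=
    MvPolynomial.funext fun x => by
      rw [MvPolynomial.eval_map, map_zero, ← MvPolynomial.aeval_def]
      exact h x
  exact MvPolynomial.map_injective _ (algebraMap ℚ ℝ).injective (by rw [h', map_zero])

/-- **Density of the non-vanishing locus**: inside an open set `W`, the complement of the zero set
of a non-zero rational polynomial is dense in `W`. [cite: BochnakCosteRoy1998, §2.8] -/
theorem mem_closure_inter_setOf_aeval_ne_zero {M : ℕ} {W : Set (Fin M → ℝ)} (hW : IsOpen W)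
    {q : MvPolynomial (Fin M) ℚ} (hq : q ≠ 0) {x : Fin M → ℝ} (hx : x ∈ W) :
    x ∈ closure (W ∩ {y | aeval y q ≠ 0}) := by
  have hint : interior {y : Fin M → ℝ | aeval y q = 0} = ∅ :=
    interior_setOf_aeval_eq_zero q (exists_aeval_ne_zero hq)
  rw [mem_closure_iff_nhds]
  intro U hU
  have hO : interior (U ∩ W) ∈ 𝓝 x := interior_mem_nhds.mpr (inter_mem hU (hW.mem_nhds hx))
  by_contra hne
  rw [not_nonempty_iff_eq_empty] at hne
  have hsub : interior (U ∩ W) ⊆ {y : Fin M → ℝ | aeval y q = 0} := by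
    intro y hy
    by_contra hy0
    have hyUW := interior_subset hy
    have : y ∈ U ∩ (W ∩ {y | aeval y q ≠ 0}) := ⟨hyUW.1, hyUW.2, hy0⟩
    rw [hne] at this
    exact this
  have hsub' : interior (U ∩ W) ⊆ interior {y : Fin M → ℝ | aeval y q = 0} :=
    interior_maximal hsub isOpen_interior
  rw [hint] at hsub'
  exact hsub' (mem_of_mem_nhds hO)

/-- **The graph of a continuous function over `W` is the trace over `W` of the closure of its
graph over a dense subset `D ⊆ W`.** [folklore] -/
theorem graph_eq_closure_graph_inter {M : ℕ} {W D : Set (Fin M → ℝ)} (hDW : D ⊆ W)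
    (hdense : W ⊆ closure D) {g : (Fin M → ℝ) → ℝ} (hg : ContinuousOn g W) :
    {z : Fin (M + 1) → ℝ | Fin.init z ∈ W ∧ z (Fin.last M) = g (Fin.init z)} =
      closure {z : Fin (M + 1) → ℝ | Fin.init z ∈ D ∧ z (Fin.last M) = g (Fin.init z)} ∩
        {z | Fin.init z ∈ W} := by
  have hinit : Continuous fun z : Fin (M + 1) → ℝ => Fin.init z :=
    continuous_pi fun i => continuous_apply _
  -- limits of `g` along sequences of `D` converging in `W`
  have hlim : ∀ (y : ℕ → Fin M → ℝ) (x : Fin M → ℝ), (∀ n, y n ∈ D) → x ∈ W →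
      Tendsto y atTop (𝓝 x) → Tendsto (fun n => g (y n)) atTop (𝓝 (g x)) := by
    intro y x hy hx hyx
    exact (hg x hx).tendsto.comp
      (tendsto_nhdsWithin_iff.mpr ⟨hyx, Eventually.of_forall fun n => hDW (hy n)⟩)
  apply Subset.antisymm
  · rintro z ⟨hzW, hzg⟩
    refine ⟨?_, hzW⟩
    obtain ⟨y, hyD, hyx⟩ := mem_closure_iff_seq_limit.mp (hdense hzW)
    refine mem_closure_iff_seq_limit.mpr
      ⟨fun n => (Fin.snoc (α := fun _ : Fin (M + 1) => ℝ) (y n) (g (y n))), fun n => ?_, ?_⟩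
    · refine ⟨?_, ?_⟩
      · show Fin.init (Fin.snoc (α := fun _ : Fin (M + 1) => ℝ) (y n) (g (y n))) ∈ D
        rw [Fin.init_snoc]
        exact hyD n
      · show (Fin.snoc (α := fun _ : Fin (M + 1) => ℝ) (y n) (g (y n))) (Fin.last M) =
          g (Fin.init (Fin.snoc (α := fun _ : Fin (M + 1) => ℝ) (y n) (g (y n))))
        rw [Fin.init_snoc, Fin.snoc_last]
    · have h := Filter.Tendsto.finSnoc (A := fun _ : Fin (M + 1) => ℝ) hyx (hlim y _ hyD hzW hyx)
      rwa [← hzg, Fin.snoc_init_self] at h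
  · rintro z ⟨hzcl, hzW⟩
    refine ⟨hzW, ?_⟩
    obtain ⟨w, hwD, hwz⟩ := mem_closure_iff_seq_limit.mp hzcl
    have h1 : Tendsto (fun n => Fin.init (w n)) atTop (𝓝 (Fin.init z)) :=
      (hinit.tendsto z).comp hwz
    have h2 : Tendsto (fun n => w n (Fin.last M)) atTop (𝓝 (z (Fin.last M))) :=
      ((continuous_apply (Fin.last M)).tendsto z).comp hwz
    have h3 : Tendsto (fun n => g (Fin.init (w n))) atTop (𝓝 (g (Fin.init z))) :=
      hlim _ _ (fun n => (hwD n).1) hzW h1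
    have h4 : (fun n => w n (Fin.last M)) = fun n => g (Fin.init (w n)) :=
      funext fun n => (hwD n).2
    rw [h4] at h2
    exact tendsto_nhds_unique h2 h3

end Bookkeeping

/-! ## The value function `(x, t, u) ↦ Σₙ qₙ(x) (t + iu)ⁿ` on `ℝᴹ⁺²` -/

section ValueFunction

variable {M : ℕ} (Q : Polynomial (MvPolynomial (Fin M) ℚ))

/-- The real and imaginary parts of `(x, t, u) ↦ Σₙ qₙ(x) (t + iu)ⁿ` are `ℚ`-semialgebraic
functions on `ℝᴹ⁺²`. [cite: BochnakCosteRoy1998, Prop. 2.2.6] -/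
theorem re_im_valueFunction :
    IsSemialgebraicFunOn ℚ (univ : Set (Fin (M + 2) → ℝ)) (fun z =>
      (∑ n ∈ Finset.range (Q.natDegree + 1),
        ((aeval (fun l : Fin M => z l.castSucc.castSucc) (Q.coeff n) : ℝ) : ℂ) *
          (((z (Fin.last M).castSucc : ℝ) : ℂ) + ((z (Fin.last (M + 1)) : ℝ) : ℂ) * Complex.I) ^ n).re) ∧
    IsSemialgebraicFunOn ℚ (univ : Set (Fin (M + 2) → ℝ)) (fun z =>
      (∑ n ∈ Finset.range (Q.natDegree + 1),
        ((aeval (fun l : Fin M => z l.castSucc.castSucc) (Q.coeff n) : ℝ) : ℂ) *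
          (((z (Fin.last M).castSucc : ℝ) : ℂ) + ((z (Fin.last (M + 1)) : ℝ) : ℂ) * Complex.I) ^ n).im) := by
  have hu : IsSemialgebraic ℚ (univ : Set (Fin (M + 2) → ℝ)) := isSemialgebraic_univ
  have hcoef : ∀ n, IsSemialgebraicFunOn ℚ (univ : Set (Fin (M + 2) → ℝ))
      (fun z => aeval (fun l : Fin M => z l.castSucc.castSucc) (Q.coeff n)) := fun n =>
    (isSemialgebraicFunOn_aeval hu
      (rename (fun l : Fin M => l.castSucc.castSucc) (Q.coeff n))).congr fun z _ => by
        dsimp only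
        rw [aeval_rename]
        rfl
  have hw : IsSemialgebraicFunOn ℚ (univ : Set (Fin (M + 2) → ℝ)) (fun z =>
        ((((z (Fin.last M).castSucc : ℝ) : ℂ) + ((z (Fin.last (M + 1)) : ℝ) : ℂ) * Complex.I)).re) ∧
      IsSemialgebraicFunOn ℚ (univ : Set (Fin (M + 2) → ℝ)) (fun z =>
        ((((z (Fin.last M).castSucc : ℝ) : ℂ) + ((z (Fin.last (M + 1)) : ℝ) : ℂ) * Complex.I)).im) := by
    refine ⟨(isSemialgebraicFunOn_aeval hu (X (Fin.last M).castSucc)).congr fun z _ => ?_,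
      (isSemialgebraicFunOn_aeval hu (X (Fin.last (M + 1)))).congr fun z _ => ?_⟩
    · simp
    · simp
  exact re_im_finset_sum hu _ _ fun n _ =>
    re_im_mul (re_im_ofReal hu (hcoef n)) (re_im_pow hu hw n)

/-- The value function at a point `(x, t, u)` written with `Fin.snoc`. [folklore] -/
theorem valueFunction_snoc_snoc (x : Fin M → ℝ) (t u : ℝ) :
    (∑ n ∈ Finset.range (Q.natDegree + 1),
        ((aeval (fun l : Fin M => (Fin.snoc (Fin.snoc x t : Fin (M + 1) → ℝ) u : Fin (M + 2) → ℝ)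
            l.castSucc.castSucc) (Q.coeff n) : ℝ) : ℂ) *
          ((((Fin.snoc (Fin.snoc x t : Fin (M + 1) → ℝ) u : Fin (M + 2) → ℝ)
              (Fin.last M).castSucc : ℝ) : ℂ) +
            (((Fin.snoc (Fin.snoc x t : Fin (M + 1) → ℝ) u : Fin (M + 2) → ℝ)
              (Fin.last (M + 1)) : ℝ) : ℂ) * Complex.I) ^ n) =
      ∑ n ∈ Finset.range (Q.natDegree + 1),
        ((aeval x (Q.coeff n) : ℝ) : ℂ) * ((t : ℂ) + (u : ℂ) * Complex.I) ^ n := by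
  have hx : (fun l : Fin M => (Fin.snoc (Fin.snoc x t : Fin (M + 1) → ℝ) u : Fin (M + 2) → ℝ)
      l.castSucc.castSucc) = x := by
    funext l
    simp only [Fin.snoc_castSucc]
  rw [hx]
  simp only [Fin.snoc_castSucc, Fin.snoc_last]

/-- The value function at `(x, t, u)` is the value at `t + iu` of the complex polynomial
`Σₙ qₙ(x) Yⁿ`. [folklore] -/
theorem valueFunction_eq_eval_map (x : Fin M → ℝ) (w : ℂ) :
    ∑ n ∈ Finset.range (Q.natDegree + 1), ((aeval x (Q.coeff n) : ℝ) : ℂ) * w ^ n =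
      (Q.map (Complex.ofRealHom.comp (MvPolynomial.eval₂Hom (algebraMap ℚ ℝ) x))).eval w := by
  rw [Polynomial.eval_map, Polynomial.eval₂_eq_sum_range]
  rfl

/-- **Finite fibres**: if some `qₙ(x) ≠ 0`, only finitely many real parts `t` of complex zeros
`t + iu` of `Σₙ qₙ(x) Yⁿ` occur. [folklore] -/
theorem finite_re_roots (x : Fin M → ℝ) (hx : ∃ n, aeval x (Q.coeff n) ≠ 0) :
    {t : ℝ | ∃ u : ℝ, ∑ n ∈ Finset.range (Q.natDegree + 1),
      ((aeval x (Q.coeff n) : ℝ) : ℂ) * ((t : ℂ) + (u : ℂ) * Complex.I) ^ n = 0}.Finite := by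
  set Qx := Q.map (Complex.ofRealHom.comp (MvPolynomial.eval₂Hom (algebraMap ℚ ℝ) x)) with hQx
  have hQx0 : Qx ≠ 0 := by
    obtain ⟨n, hn⟩ := hx
    intro h
    have h' := congrArg (fun P : Polynomial ℂ => P.coeff n) h
    simp only [hQx, Polynomial.coeff_map, Polynomial.coeff_zero, RingHom.comp_apply,
      Complex.ofRealHom_eq_coe, Complex.ofReal_eq_zero] at h'
    exact hn h'
  refine ((Polynomial.finite_setOf_isRoot hQx0).image Complex.re).subset ?_
  rintro t ⟨u, hu⟩
  refine ⟨(t : ℂ) + (u : ℂ) * Complex.I, ?_, by simp⟩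
  rw [mem_setOf_eq, Polynomial.IsRoot.def, hQx, ← valueFunction_eq_eval_map]
  exact hu

end ValueFunction

/-! ## The theorem -/

/-- **A continuous real part of a solution of a non-trivial rational polynomial identity is
`ℚ`-semialgebraic.** Let `W ⊆ ℝᴹ` be open and `ℚ`-semialgebraic, `g` continuous on `W` with
`g = re k` on `W`, and `Σₙ qₙ(x) k(x)ⁿ = 0` on `W` for a non-zero `Q = Σₙ qₙ Yⁿ ∈ ℚ[x][Y]`. Then `g`
is `ℚ`-semialgebraic on `W` (semialgebraic selection along the continuous branch `g` over the dense
locus where some `qₙ ≠ 0`, then closure). [cite: BasuPollackRoy2006, Thm. 5.6, Cor. 5.7 and Prop. 5.3] -/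
theorem isSemialgebraicFunOn_re_of_polynomial_identity {M : ℕ} {W : Set (Fin M → ℝ)}
    (hWo : IsOpen W) (hWs : IsSemialgebraic ℚ W) {g : (Fin M → ℝ) → ℝ} (hg : ContinuousOn g W)
    {k : (Fin M → ℝ) → ℂ} (hre : ∀ x ∈ W, (k x).re = g x)
    (Q : Polynomial (MvPolynomial (Fin M) ℚ)) (hQ : Q ≠ 0)
    (hid : ∀ x ∈ W, ∑ n ∈ Finset.range (Q.natDegree + 1),
      ((aeval x (Q.coeff n) : ℝ) : ℂ) * k x ^ n = 0) :
    IsSemialgebraicFunOn ℚ W g := by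
  classical
  -- a non-zero coefficient
  obtain ⟨n₀, hn₀⟩ : ∃ n, Q.coeff n ≠ 0 := by
    by_contra h
    push Not at h
    exact hQ (Polynomial.ext fun n => by rw [h n, Polynomial.coeff_zero])
  have hn₀d : n₀ ∈ Finset.range (Q.natDegree + 1) :=
    Finset.mem_range.mpr (Nat.lt_succ_of_le (Polynomial.le_natDegree_of_ne_zero hn₀))
  -- the non-degeneracy locus `D ⊆ W`
  set D : Set (Fin M → ℝ) := W ∩ {x | ∃ n ∈ Finset.range (Q.natDegree + 1), aeval x (Q.coeff n) ≠ 0}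
    with hD
  have hDs : IsSemialgebraic ℚ D := by
    have h : {x : Fin M → ℝ | ∃ n ∈ Finset.range (Q.natDegree + 1), aeval x (Q.coeff n) ≠ 0} =
        ⋃ n ∈ Finset.range (Q.natDegree + 1), {x | aeval x (Q.coeff n) ≠ 0} := by
      ext x
      simp only [mem_setOf_eq, mem_iUnion, exists_prop]
    rw [hD, h]
    exact hWs.inter (IsSemialgebraic.biUnion _ _ fun n _ => isSemialgebraic_setOf_eval_ne_zero _)
  have hDW : D ⊆ W := fun x hx => hx.1
  -- the lifted zero set in `ℝᴹ⁺²` and its projection to `ℝᴹ⁺¹`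
  set S₃ : Set (Fin (M + 2) → ℝ) := {z | z ∈ (univ : Set (Fin (M + 2) → ℝ)) ∧
      (∑ n ∈ Finset.range (Q.natDegree + 1),
        ((aeval (fun l : Fin M => z l.castSucc.castSucc) (Q.coeff n) : ℝ) : ℂ) *
          (((z (Fin.last M).castSucc : ℝ) : ℂ) + ((z (Fin.last (M + 1)) : ℝ) : ℂ) * Complex.I) ^ n)
        = 0} ∩
    {z | ∃ n ∈ Finset.range (Q.natDegree + 1),
      aeval (fun l : Fin M => z l.castSucc.castSucc) (Q.coeff n) ≠ 0} with hS₃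
  have hS₃s : IsSemialgebraic ℚ S₃ := by
    refine (isSemialgebraic_sep_eq_zero_complex (re_im_valueFunction Q)).inter ?_
    have h : {z : Fin (M + 2) → ℝ | ∃ n ∈ Finset.range (Q.natDegree + 1),
        aeval (fun l : Fin M => z l.castSucc.castSucc) (Q.coeff n) ≠ 0} =
        ⋃ n ∈ Finset.range (Q.natDegree + 1),
          {z | aeval z (rename (fun l : Fin M => l.castSucc.castSucc) (Q.coeff n)) ≠ 0} := by
      ext z
      simp only [mem_setOf_eq, mem_iUnion, exists_prop, aeval_rename]
      rfl
    rw [h]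
    exact IsSemialgebraic.biUnion _ _ fun n _ => isSemialgebraic_setOf_eval_ne_zero _
  set σ₂ : Set (Fin (M + 1) → ℝ) := (fun v : Fin (M + 2) → ℝ => v ∘ Fin.castSucc) '' S₃ with hσ₂
  have hσ₂s : IsSemialgebraic ℚ σ₂ := tarski_seidenberg_real_holds hS₃s
  -- membership in `S₃` and `σ₂`
  have hmemS₃ : ∀ (x : Fin M → ℝ) (t u : ℝ),
      (Fin.snoc (Fin.snoc x t : Fin (M + 1) → ℝ) u : Fin (M + 2) → ℝ) ∈ S₃ ↔
        (∑ n ∈ Finset.range (Q.natDegree + 1),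
          ((aeval x (Q.coeff n) : ℝ) : ℂ) * ((t : ℂ) + (u : ℂ) * Complex.I) ^ n = 0) ∧
        ∃ n ∈ Finset.range (Q.natDegree + 1), aeval x (Q.coeff n) ≠ 0 := by
    intro x t u
    have hx : (fun l : Fin M => (Fin.snoc (Fin.snoc x t : Fin (M + 1) → ℝ) u : Fin (M + 2) → ℝ)
        l.castSucc.castSucc) = x := by
      funext l
      simp only [Fin.snoc_castSucc]
    rw [hS₃, mem_inter_iff, mem_setOf_eq, mem_setOf_eq, valueFunction_snoc_snoc, hx]
    simp only [mem_univ, true_and]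
  have hmemσ₂ : ∀ (x : Fin M → ℝ) (t : ℝ), (Fin.snoc x t : Fin (M + 1) → ℝ) ∈ σ₂ ↔
      ∃ u : ℝ, (Fin.snoc (Fin.snoc x t : Fin (M + 1) → ℝ) u : Fin (M + 2) → ℝ) ∈ S₃ :=
    fun x t => mem_image_comp_castSucc_iff
  -- finite fibres
  have hfin : ∀ x : Fin M → ℝ, {t : ℝ | (Fin.snoc x t : Fin (M + 1) → ℝ) ∈ σ₂}.Finite := by
    intro x
    by_cases hx : ∃ n, aeval x (Q.coeff n) ≠ 0
    · refine (finite_re_roots Q x hx).subset ?_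
      intro t ht
      obtain ⟨u, hu⟩ := (hmemσ₂ x t).mp ht
      exact ⟨u, ((hmemS₃ x t u).mp hu).1⟩
    · have hempty : {t : ℝ | (Fin.snoc x t : Fin (M + 1) → ℝ) ∈ σ₂} = ∅ := by
        ext t
        simp only [mem_setOf_eq, mem_empty_iff_false, iff_false]
        intro ht
        obtain ⟨u, hu⟩ := (hmemσ₂ x t).mp ht
        obtain ⟨n, -, hn⟩ := ((hmemS₃ x t u).mp hu).2
        exact hx ⟨n, hn⟩
      rw [hempty]
      exact finite_empty
  -- `g` is semialgebraic on `D` by selection along the continuous branch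
  have hgD : IsSemialgebraicFunOn ℚ D g := by
    refine isSemialgebraicFunOn_of_continuousOn_of_finite_fibres hσ₂s hfin hDs (hg.mono hDW)
      fun x hx => ?_
    rw [hmemσ₂]
    refine ⟨(k x).im, (hmemS₃ x (g x) (k x).im).mpr ⟨?_, hx.2⟩⟩
    have hk : ((g x : ℝ) : ℂ) + (((k x).im : ℝ) : ℂ) * Complex.I = k x := by
      rw [← hre x hx.1, Complex.re_add_im]
    rw [hk]
    exact hid x hx.1
  -- `D` is dense in `W`
  have hdense : W ⊆ closure D := by
    intro x hx
    refine closure_mono ?_ (mem_closure_inter_setOf_aeval_ne_zero hWo hn₀ hx)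
    rintro y ⟨hyW, hy⟩
    exact ⟨hyW, n₀, hn₀d, hy⟩
  -- conclusion: the graph over `W` is the trace of the closure of the graph over `D`
  rw [isSemialgebraicFunOn_iff, graph_eq_closure_graph_inter hDW hdense hg]
  exact (isSemialgebraic_closure (isSemialgebraicFunOn_iff.mp hgD)).inter hWs.setOf_init_mem

/-! ## Registered form -/

/-- **Registered auxiliary stub** `stub_spanToRepsAuxSemialg` (sub-goal of `stub_spanToReps`, crux
stmt-KontsevichZagierPeriods-3586): a continuous function on an open `ℚ`-semialgebraic `W ⊆ ℝᴹ` which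
is the real part of a solution of a non-trivial polynomial identity with coefficients in
`ℚ[x₁, …, x_M]` is `ℚ`-semialgebraic on `W` (= `isSemialgebraicFunOn_re_of_polynomial_identity`).
[cite: BasuPollackRoy2006, Thm. 5.6, Cor. 5.7 and Prop. 5.3] -/
theorem stub_spanToRepsAuxSemialg :
    ∀ (M : ℕ) (W : Set (Fin M → ℝ)) (g : (Fin M → ℝ) → ℝ) (k : (Fin M → ℝ) → ℂ)
      (Q : Polynomial (MvPolynomial (Fin M) ℚ)),
      IsOpen W → Literature.ModelTheory.ExponentialFields.IsSemialgebraic ℚ W → ContinuousOn g W →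
      (∀ x ∈ W, (k x).re = g x) → Q ≠ 0 →
      (∀ x ∈ W, ∑ n ∈ Finset.range (Q.natDegree + 1),
        ((MvPolynomial.aeval x (Q.coeff n) : ℝ) : ℂ) * k x ^ n = 0) →
      IsSemialgebraicFunOn ℚ W g :=
  fun _ _ _ _ Q hWo hWs hg hre hQ hid =>
    isSemialgebraicFunOn_re_of_polynomial_identity hWo hWs hg hre Q hQ hid

end Summit.KontsevichZagierPeriods.KontsevichZagierPeriods.StokesGenerationLine
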